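import Summits.NavierStokesRegularity.NavierStokesRegularity.Theorems.ThreadingFluxCentreVirialHodgeWeighted
import HarnessLib

/-!
# Hodge slaving, sphere-free — V: the Bochner inequality WITH VORTICITY DEFECT (no unthreadedness assumed)

* `half_trace_sq_le_defect`: if `⟪A h, y⟫ = −⟪w, h⟫` (`w ⊥ y`) and the antisymmetric part of `A` is `½ v×`
  (`⟪A a, b⟫ − ⟪A b, a⟫ = ⟪v, a × b⟫`) then `(tr A)²/2 ≤ tr(A∘A) + 2|y|⁻²⟪w, A y⟫ + ⟪v, y⟫²/(2|y|²)` — the symmetric-block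
  inequality of part I with the explicit defect (axial operator `crossOp`, `tr(K∘K) = −2|q|²`, `tr(S∘K) = 0` for symmetric `S`);
* `divergence_bochnerField_add_le_defect`: `div Q + |W|²/|y|² ≤ ½(div W)² + ⟪curl W, y⟫²/(2|y|²)` for tangential `W ∈ C²`
  (the antisymmetric part of `DW` is `½ curl W ×`, tree `inner_curl_cross`);
* `weighted_bochner_ineq_defect`: `∫κ(|y|²)|W|²/|y|² ≤ ½∫κ(|y|²)(div W)² + ½∫κ(|y|²)⟪curl W, y⟫²/|y|²`.

Part of the sphere-free proof of Hodge slaving (H of the centre-virial card, ns-idea-15 g9; twin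
`ThreadingFluxCentreVirialDefs`).  Folklore analysis re-derived in ambient coordinates; information-grade; W1 movement 0;
`PoloidalLiouville` (1222), T0, Galdi's problem OPEN; NS regularity is NOT proved.
`--supports stmt-NavierStokesRegularity-1222 --as helper`.  Filed by ns-wall-eng-4 g6 (cell ns-wall-extremal).
[cite: KorobkovPileckasRusso2015, Thm 3.6]
-/

-- the summit and its single sub-problem share the name (CONVENTIONS §1)
set_option linter.dupNamespace false

noncomputable section

namespace Summit.NavierStokesRegularity.NavierStokesRegularity.Theorems.PoloidalLiouville.CentreVirial

open Set Function MeasureTheory Filter Topology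
open Literature.Analysis.FluidPDE
open Literature.Analysis.FluidPDE.VectorCalculus (divergence IsDivFree)
open Summit.NavierStokesRegularity.NavierStokesRegularity.Theorems.PoloidalLiouville.CentreJet
  (E3 IsUnthreadedAbout IsSteadyNSOn)
open scoped RealInnerProductSpace

namespace Hodge

/-! ### Quantitative version: no symmetry hypothesis, an explicit antisymmetric defect -/

section Defect

/-- The axial operator `K_q a = q × a`, as a linear map. -/
def crossOp (q : E3) : E3 →ₗ[ℝ] E3 := ((crossCLM q : E3 →L[ℝ] E3) : E3 →ₗ[ℝ] E3)

/-- Unfolding `crossOp`. -/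
theorem crossOp_apply (q a : E3) : crossOp q a = cross q a := rfl

/-- `⟪q × a, b⟫ = −⟪a, q × b⟫`. -/
theorem inner_crossOp_antisymm (q a b : E3) : ⟪crossOp q a, b⟫ = -⟪a, crossOp q b⟫ := by
  simp only [crossOp_apply, cross, PiLp.inner_apply, cross_apply, RCLike.inner_apply, conj_trivial,
    Fin.sum_univ_three, Matrix.cons_val_zero, Matrix.cons_val_one, Matrix.cons_val_two,
    Matrix.head_cons, Matrix.tail_cons]
  ring

/-- `(t y) × y = 0`. -/
theorem crossOp_smul_self (t : ℝ) (y : E3) : crossOp (t • y) y = 0 := by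
  ext i
  fin_cases i <;> simp [crossOp_apply, cross]

/-- `⟪y, (t y) × a⟫ = 0`. -/
theorem inner_self_crossOp_smul (t : ℝ) (y a : E3) : ⟪y, crossOp (t • y) a⟫ = 0 := by
  simp only [crossOp_apply, cross, PiLp.inner_apply, cross_apply, RCLike.inner_apply, conj_trivial, PiLp.smul_apply,
    smul_eq_mul, Fin.sum_univ_three, Matrix.cons_val_zero, Matrix.cons_val_one, Matrix.cons_val_two,
    Matrix.head_cons, Matrix.tail_cons]
  ring

/-- `tr(K_q ∘ K_q) = −2|q|²`. -/
theorem trace_crossOp_comp_self (q : E3) :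
    LinearMap.trace ℝ E3 (crossOp q ∘ₗ crossOp q) = -2 * ‖q‖ ^ 2 := by
  rw [LinearMap.trace_eq_sum_inner _ (EuclideanSpace.basisFun (Fin 3) ℝ),
    ← real_inner_self_eq_norm_sq, Fin.sum_univ_three]
  simp only [LinearMap.coe_comp, Function.comp_apply, crossOp_apply, cross, EuclideanSpace.basisFun_apply,
    PiLp.inner_apply, cross_apply, RCLike.inner_apply, conj_trivial, Fin.sum_univ_three, Matrix.cons_val_zero,
    Matrix.cons_val_one, Matrix.cons_val_two, Matrix.head_cons, Matrix.tail_cons, PiLp.single_apply]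
  simp
  ring

/-- `tr K_q = 0`. -/
theorem trace_crossOp (q : E3) : LinearMap.trace ℝ E3 (crossOp q) = 0 := by
  rw [LinearMap.trace_eq_sum_inner _ (EuclideanSpace.basisFun (Fin 3) ℝ), Fin.sum_univ_three]
  simp only [crossOp_apply, cross, EuclideanSpace.basisFun_apply,
    PiLp.inner_apply, cross_apply, RCLike.inner_apply, conj_trivial, Fin.sum_univ_three, Matrix.cons_val_zero,
    Matrix.cons_val_one, Matrix.cons_val_two, Matrix.head_cons, Matrix.tail_cons, PiLp.single_apply]
  simp

/-- For a self-adjoint `S` and the antisymmetric `K_q`, `tr(S ∘ K_q) = 0`. -/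
theorem trace_symm_comp_crossOp {S : E3 →ₗ[ℝ] E3} (hS : ∀ a b : E3, ⟪S a, b⟫ = ⟪a, S b⟫) (q : E3) :
    LinearMap.trace ℝ E3 (S ∘ₗ crossOp q) = 0 := by
  set b := EuclideanSpace.basisFun (Fin 3) ℝ
  have h1 : LinearMap.trace ℝ E3 (S ∘ₗ crossOp q) = ∑ i, ⟪S (b i), crossOp q (b i)⟫ := by
    rw [LinearMap.trace_eq_sum_inner _ b]
    refine Finset.sum_congr rfl fun i _ => ?_
    rw [LinearMap.coe_comp, Function.comp_apply, ← hS]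
  have h2 : LinearMap.trace ℝ E3 (S ∘ₗ crossOp q) = -∑ i, ⟪S (b i), crossOp q (b i)⟫ := by
    rw [LinearMap.trace_comp_comm', LinearMap.trace_eq_sum_inner _ b, ← Finset.sum_neg_distrib]
    refine Finset.sum_congr rfl fun i _ => ?_
    rw [LinearMap.coe_comp, Function.comp_apply, ← real_inner_comm (b i), inner_crossOp_antisymm, real_inner_comm]
  linarith

/-- For `p, r ⊥ y`: `⟪v, p × r⟫ = |y|⁻² ⟪v, y⟫ ⟪p × r, y⟫`. -/
theorem inner_cross_of_orth {p r y : E3} (v : E3) (hy : y ≠ 0) (hp : ⟪p, y⟫ = 0) (hr : ⟪r, y⟫ = 0) :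
    ⟪v, cross p r⟫ = (‖y‖ ^ 2)⁻¹ * ⟪v, y⟫ * ⟪cross p r, y⟫ := by
  have hn : ‖y‖ ^ 2 ≠ 0 := pow_ne_zero 2 (norm_ne_zero_iff.2 hy)
  have ht := triple_product_expand p r v y
  rw [real_inner_comm p, hp, real_inner_comm r, hr, zero_mul, zero_mul, zero_add, zero_add,
    real_inner_comm v (cross p r), real_inner_comm v y] at ht
  field_simp
  linarith [ht]

/-- ★ **The trace inequality with the antisymmetric defect.**  If `⟪A h, y⟫ = −⟪w, h⟫` (`w ⊥ y`, `y ≠ 0`) and the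
antisymmetric part of `A` is `½ v ×` (`⟪A a, b⟫ − ⟪A b, a⟫ = ⟪v, a × b⟫`), then
`(tr A)²/2 ≤ tr(A∘A) + 2|y|⁻²⟪w, A y⟫ + ⟪v, y⟫²/(2|y|²)`. -/
theorem half_trace_sq_le_defect {A : E3 →ₗ[ℝ] E3} {y w v : E3} (hy : y ≠ 0) (hwy : ⟪w, y⟫ = 0)
    (hA : ∀ h, ⟪A h, y⟫ = -⟪w, h⟫)
    (hskew : ∀ a b : E3, ⟪A a, b⟫ - ⟪A b, a⟫ = ⟪v, cross a b⟫) :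
    (LinearMap.trace ℝ E3 A) ^ 2 / 2 ≤
      LinearMap.trace ℝ E3 (A ∘ₗ A) + 2 * (‖y‖ ^ 2)⁻¹ * ⟪w, A y⟫ + (‖y‖ ^ 2)⁻¹ * ⟪v, y⟫ ^ 2 / 2 := by
  have hn : ‖y‖ ^ 2 ≠ 0 := pow_ne_zero 2 (norm_ne_zero_iff.2 hy)
  set c : ℝ := (‖y‖ ^ 2)⁻¹ with hc
  set P := proj y with hP
  set R := rankOne y (A y) with hR
  set X := A ∘ₗ P with hX
  set M := P ∘ₗ X with hM
  have hPP : P ∘ₗ P = P := proj_comp_proj hy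
  have hyAy : ⟪y, A y⟫ = 0 := by rw [real_inner_comm, hA, hwy, neg_zero]
  have hXdef : X = A - c • R := by
    rw [hX, hP, proj, LinearMap.comp_sub, LinearMap.comp_id, LinearMap.comp_smul, comp_rankOne]
  have hXP : X ∘ₗ P = X := by rw [hX, LinearMap.comp_assoc, hPP]
  have htrM : LinearMap.trace ℝ E3 M = LinearMap.trace ℝ E3 A := by
    rw [hM, LinearMap.trace_comp_comm', hXP, hXdef, map_sub, map_smul, hR, trace_rankOne, hyAy, smul_zero, sub_zero]
  have hMM : M ∘ₗ M = P ∘ₗ (X ∘ₗ X) := by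
    rw [hM, LinearMap.comp_assoc, ← LinearMap.comp_assoc X P X, hXP]
  have htrAR : LinearMap.trace ℝ E3 (A ∘ₗ R) = -⟪w, A y⟫ := by
    rw [hR, trace_comp_rankOne, real_inner_comm, hA]
  have htrRA : LinearMap.trace ℝ E3 (R ∘ₗ A) = -⟪w, A y⟫ := by
    rw [LinearMap.trace_comp_comm', htrAR]
  have htrRR : LinearMap.trace ℝ E3 (R ∘ₗ R) = 0 := by
    rw [hR, comp_rankOne, rankOne_apply, hyAy, zero_smul, trace_rankOne, inner_zero_right]
  have htrMM : LinearMap.trace ℝ E3 (M ∘ₗ M) =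
      LinearMap.trace ℝ E3 (A ∘ₗ A) + 2 * c * ⟪w, A y⟫ := by
    rw [hMM, LinearMap.trace_comp_comm', LinearMap.comp_assoc, hXP]
    have e : X ∘ₗ X = A ∘ₗ A - c • (A ∘ₗ R) - c • (R ∘ₗ A) + (c * c) • (R ∘ₗ R) := by
      rw [hXdef]
      simp only [LinearMap.sub_comp, LinearMap.comp_sub, LinearMap.smul_comp, LinearMap.comp_smul, smul_sub,
        smul_smul]
      abel
    rw [e, map_add, map_sub, map_sub, map_smul, map_smul, map_smul, htrAR, htrRA, htrRR]
    simp only [smul_eq_mul]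
    ring
  -- the antisymmetric part of `M` is `½ K_q`, `q = c⟪v, y⟫ y`
  set q : E3 := (c * ⟪v, y⟫) • y with hq
  set K := crossOp q with hK
  have hPsym : ∀ a b : E3, ⟪P a, b⟫ = ⟪a, P b⟫ := fun a b => inner_proj_symm y a b
  have hMskew : ∀ a b : E3, ⟪M a, b⟫ - ⟪a, M b⟫ = ⟪K a, b⟫ := by
    intro a b
    have e1 : M a = P (A (P a)) := rfl
    have e2 : M b = P (A (P b)) := rfl
    rw [e1, e2, hPsym, ← hPsym a, ← real_inner_comm (P a) (A (P b)), hskew (P a) (P b),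
      inner_cross_of_orth v hy (inner_proj_left y a hy) (inner_proj_left y b hy)]
    -- `⟪Pa × Pb, y⟫ = ⟪a × b, y⟫ = ⟪y × a, b⟫`
    have h3 : ⟪cross (P a) (P b), y⟫ = ⟪cross a b, y⟫ := by
      rw [hP, proj_apply, proj_apply]
      simp only [cross, PiLp.inner_apply, cross_apply, RCLike.inner_apply, conj_trivial, PiLp.sub_apply,
        PiLp.smul_apply, smul_eq_mul, Fin.sum_univ_three, Matrix.cons_val_zero, Matrix.cons_val_one,
        Matrix.cons_val_two, Matrix.head_cons, Matrix.tail_cons]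
      ring
    rw [h3, hK, crossOp_apply, hq]
    simp only [cross, PiLp.inner_apply, cross_apply, RCLike.inner_apply, conj_trivial, PiLp.smul_apply,
      smul_eq_mul, Fin.sum_univ_three, Matrix.cons_val_zero, Matrix.cons_val_one, Matrix.cons_val_two,
      Matrix.head_cons, Matrix.tail_cons]
    ring
  set S := M - (1 / 2 : ℝ) • K with hS
  have hSsym : ∀ a b : E3, ⟪S a, b⟫ = ⟪a, S b⟫ := by
    intro a b
    have h1 := hMskew a b
    have h2 := inner_crossOp_antisymm q a b
    simp only [hS, LinearMap.sub_apply, LinearMap.smul_apply, inner_sub_left, inner_sub_right, real_inner_smul_left,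
      real_inner_smul_right]
    rw [hK] at h1
    linarith
  have hKP : K ∘ₗ P = K := by
    refine LinearMap.ext fun a => ?_
    rw [LinearMap.coe_comp, Function.comp_apply, hP, proj_apply, map_sub, map_smul, hK, hq, crossOp_smul_self, smul_zero,
      sub_zero]
  have hPK : P ∘ₗ K = K := by
    refine LinearMap.ext fun a => ?_
    rw [LinearMap.coe_comp, Function.comp_apply, hP, proj_apply, hK, hq, inner_self_crossOp_smul, mul_zero, zero_smul,
      sub_zero]
  have hMP : M ∘ₗ P = M := by rw [hM, LinearMap.comp_assoc, hXP]
  have hPM : P ∘ₗ M = M := by rw [hM, ← LinearMap.comp_assoc, hPP]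
  have hSP : S ∘ₗ P = S := by rw [hS, LinearMap.sub_comp, LinearMap.smul_comp, hMP, hKP]
  have hPS : P ∘ₗ S = S := by rw [hS, LinearMap.comp_sub, LinearMap.comp_smul, hPM, hPK]
  have htrS : LinearMap.trace ℝ E3 S = LinearMap.trace ℝ E3 A := by
    rw [hS, map_sub, map_smul, htrM, hK, trace_crossOp, smul_zero, sub_zero]
  -- `tr(M∘M) = tr(S∘S) − ½|q|²`
  have hMdecomp : M = S + (1 / 2 : ℝ) • K := by rw [hS]; abel
  have htrSK : LinearMap.trace ℝ E3 (S ∘ₗ K) = 0 := trace_symm_comp_crossOp hSsym q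
  have htrKS : LinearMap.trace ℝ E3 (K ∘ₗ S) = 0 := by rw [LinearMap.trace_comp_comm', htrSK]
  have htrMM' : LinearMap.trace ℝ E3 (M ∘ₗ M) = LinearMap.trace ℝ E3 (S ∘ₗ S) - (1 / 2) * ‖q‖ ^ 2 := by
    have e : M ∘ₗ M = S ∘ₗ S + (1 / 2 : ℝ) • (S ∘ₗ K) + (1 / 2 : ℝ) • (K ∘ₗ S) +
        ((1 / 2 : ℝ) * (1 / 2 : ℝ)) • (K ∘ₗ K) := by
      rw [hMdecomp]
      simp only [LinearMap.add_comp, LinearMap.comp_add, LinearMap.smul_comp, LinearMap.comp_smul, smul_add, smul_smul]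
      abel
    rw [e, map_add, map_add, map_add, map_smul, map_smul, map_smul, htrSK, htrKS, hK, trace_crossOp_comp_self]
    simp only [smul_eq_mul]
    ring
  -- `tr(S∘S) ≥ ½ (tr S)²` via the traceless part
  set t : ℝ := LinearMap.trace ℝ E3 A / 2 with ht
  set N := S - t • P with hN
  have hNsym : ∀ a b : E3, ⟪N a, b⟫ = ⟪a, N b⟫ := by
    intro a b
    simp only [hN, LinearMap.sub_apply, LinearMap.smul_apply, inner_sub_left, inner_sub_right,
      real_inner_smul_left, real_inner_smul_right, hSsym a b, hPsym a b]
  have hNN : LinearMap.trace ℝ E3 (N ∘ₗ N) =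
      LinearMap.trace ℝ E3 (S ∘ₗ S) - (LinearMap.trace ℝ E3 A) ^ 2 / 2 := by
    have e : N ∘ₗ N = S ∘ₗ S - t • (S ∘ₗ P) - t • (P ∘ₗ S) + (t * t) • (P ∘ₗ P) := by
      rw [hN]
      simp only [LinearMap.sub_comp, LinearMap.comp_sub, LinearMap.smul_comp, LinearMap.comp_smul, smul_sub,
        smul_smul]
      abel
    rw [e, hSP, hPS, hPP, map_add, map_sub, map_sub, map_smul, map_smul, htrS, trace_proj hy]
    simp only [smul_eq_mul, ht]
    ring
  have h0 := trace_comp_self_nonneg hNsym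
  have hq2 : ‖q‖ ^ 2 = c * ⟪v, y⟫ ^ 2 := by
    rw [hq, norm_smul, mul_pow, Real.norm_eq_abs, sq_abs, hc]
    field_simp
  rw [hNN] at h0
  rw [hq2] at htrMM'
  linarith [h0, htrMM, htrMM']

end Defect


/-- ★ **The pointwise Bochner inequality with vorticity defect** (no unthreadedness assumed): for `W ∈ C²` near
`x ≠ x₀`, tangential about `x₀`, `div Q (x) + |W x|²/|y|² ≤ ½ (div W x)² + ⟪curl W x, y⟫²/(2|y|²)`. -/
theorem divergence_bochnerField_add_le_defect {W : E3 → E3} {x₀ x : E3} (hW : ContDiffAt ℝ 2 W x) (hy : x - x₀ ≠ 0)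
    (htan : ∀ z, ⟪W z, z - x₀⟫ = 0) :
    divergence (bochnerField x₀ W) x + ‖W x‖ ^ 2 / ‖x - x₀‖ ^ 2 ≤
      (1 / 2) * divergence W x ^ 2 + (‖x - x₀‖ ^ 2)⁻¹ * ⟪curl W x, x - x₀⟫ ^ 2 / 2 := by
  have hW1 : DifferentiableAt ℝ W x := hW.differentiableAt (by simp)
  have hA : ∀ h, ⟪(fderiv ℝ W x : E3 →ₗ[ℝ] E3) h, x - x₀⟫ = -⟪W x, h⟫ := fun h =>
    inner_fderiv_tangential hW1 htan h
  have hskew : ∀ a b : E3, ⟪(fderiv ℝ W x : E3 →ₗ[ℝ] E3) a, b⟫ - ⟪(fderiv ℝ W x : E3 →ₗ[ℝ] E3) b, a⟫ =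
      ⟪curl W x, cross a b⟫ := fun a b => (inner_curl_cross W x a b).symm
  have key := half_trace_sq_le_defect hy (htan x) hA hskew
  have htr : LinearMap.trace ℝ E3 (fderiv ℝ W x : E3 →ₗ[ℝ] E3) = divergence W x := rfl
  rw [htr] at key
  rw [divergence_bochnerField hW hy]
  have : (fderiv ℝ W x : E3 →ₗ[ℝ] E3) (x - x₀) = fderiv ℝ W x (x - x₀) := rfl
  rw [this] at key
  linarith

/-- ★ **The weighted Bochner inequality with vorticity defect** (no unthreadedness assumed):
`∫ κ(|y|²)|W|²/|y|² ≤ ½∫κ(|y|²)(div W)² + ½∫κ(|y|²)⟪curl W, y⟫²/|y|²`.  Same proof as  For `W ∈ C²(ℝ³; ℝ³)` tangential about `x₀` and unthreaded off `x₀`, and a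
nonnegative `C¹` radial weight `κ` of the squared radius vanishing near `0` and far out:
`∫ κ(|y|²) |W|²/|y|² ≤ ½ ∫ κ(|y|²) (div W)²`.  (Sphere-wise this is `∮|v|² ≤ (r²/2)∮(div_S v)²` for curl-free
tangential `v` — Hodge/Poincaré with the sharp `λ₁(S²) = 2` — obtained here WITHOUT surface measures: `∫ div(κ(|y|²) Q) = 0`
for the tangential Bochner field `Q`, plus the pointwise inequality `div Q + |W|²/|y|² ≤ ½(div W)²`.) -/
theorem weighted_bochner_ineq_defect {W : E3 → E3} {x₀ : E3} (hW : ContDiff ℝ 2 W) (htan : ∀ z, ⟪W z, z - x₀⟫ = 0)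
    {κ : ℝ → ℝ} (hκ : ContDiff ℝ 1 κ) {α₀ S : ℝ}
    (hα₀ : 0 < α₀) (hκ0 : ∀ σ, σ ≤ α₀ → κ σ = 0) (hκS : ∀ σ, S ≤ σ → κ σ = 0) (hκnn : ∀ σ, 0 ≤ κ σ) :
    ∫ x, κ (‖x - x₀‖ ^ 2) * (‖W x‖ ^ 2 / ‖x - x₀‖ ^ 2) ≤
      ((1 / 2) * ∫ x, κ (‖x - x₀‖ ^ 2) * divergence W x ^ 2) +
        (1 / 2) * ∫ x, κ (‖x - x₀‖ ^ 2) * (⟪curl W x, x - x₀⟫ ^ 2 / ‖x - x₀‖ ^ 2) := by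
  set g : E3 → ℝ := fun x => κ (‖x - x₀‖ ^ 2) with hg_def
  have hns : ContDiff ℝ 1 fun z : E3 => ‖z - x₀‖ ^ 2 := (contDiff_id.sub contDiff_const).norm_sq ℝ
  have hg : ContDiff ℝ 1 g := hκ.comp hns
  have hρ : 0 < Real.sqrt α₀ := Real.sqrt_pos.2 hα₀
  have hg0 : ∀ x ∈ Metric.ball x₀ (Real.sqrt α₀), g x = 0 := fun x hx => radialProfile_eq_zero_of_mem_ball hκ0 hx
  have hQ : ContDiffOn ℝ 1 (bochnerField x₀ W) {x₀}ᶜ := contDiffOn_bochnerField hW x₀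
  -- the test field
  set V : E3 → E3 := fun x => g x • bochnerField x₀ W x with hV_def
  have hV : ContDiff ℝ 1 V := contDiff_smul_of_vanishing hρ hg hg0 hQ
  have hVc : HasCompactSupport V := by
    refine HasCompactSupport.intro (isCompact_closedBall x₀ (|S| + 1)) fun x hx => ?_
    rw [Metric.mem_closedBall, dist_eq_norm, not_le] at hx
    have h1 : 1 ≤ ‖x - x₀‖ := by linarith [abs_nonneg S]
    have hS' : S ≤ ‖x - x₀‖ ^ 2 := by nlinarith [le_abs_self S]
    show g x • bochnerField x₀ W x = 0
    rw [hg_def]; dsimp only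
    rw [hκS _ hS', zero_smul]
  have hint0 := integral_divergence_eq_zero hV hVc
  -- `div V = g · div Q` everywhere
  have hgrad : ∀ x, gradient g x = (2 * deriv κ (‖x - x₀‖ ^ 2)) • (x - x₀) := by
    intro x
    have h1 : HasFDerivAt (fun x : E3 => x - x₀) (ContinuousLinearMap.id ℝ E3) x := (hasFDerivAt_id x).sub_const x₀
    have h2 := h1.norm_sq
    have h3 : HasDerivAt κ (deriv κ (‖x - x₀‖ ^ 2)) (‖x - x₀‖ ^ 2) := (hκ.differentiable one_ne_zero _).hasDerivAt
    have h4 := h3.comp_hasFDerivAt x h2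
    have e : g = κ ∘ fun x : E3 => ‖x - x₀‖ ^ 2 := rfl
    rw [gradient, e, h4.fderiv]
    apply (InnerProductSpace.toDual ℝ E3).injective
    rw [LinearIsometryEquiv.apply_symm_apply]
    ext h
    simp only [_root_.FunLike.coe_smul, Pi.smul_apply, ContinuousLinearMap.comp_apply, ContinuousLinearMap.id_apply,
      innerSL_apply_apply, smul_eq_mul, InnerProductSpace.toDual_apply_apply, real_inner_smul_left]
    ring
  have hdivV : ∀ x, divergence V x = g x * divergence (bochnerField x₀ W) x := by
    intro x
    by_cases hx : x = x₀
    · subst hx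
      have hev : V =ᶠ[nhds x] fun _ => (0 : E3) :=
        Filter.eventuallyEq_of_mem (Metric.ball_mem_nhds x hρ) fun z hz => by
          show g z • bochnerField x W z = 0
          rw [hg0 z hz, zero_smul]
      have h0 : g x = 0 := hg0 x (Metric.mem_ball_self hρ)
      rw [h0, zero_mul]
      unfold VectorCalculus.divergence
      rw [hev.fderiv_eq, fderiv_const_apply]
      simp
    · have hQd : DifferentiableAt ℝ (bochnerField x₀ W) x :=
        (hQ.contDiffAt (isOpen_compl_singleton.mem_nhds hx)).differentiableAt one_ne_zero
      rw [hV_def, divergence_smul_apply (hg.differentiable one_ne_zero x) hQd, hgrad x, real_inner_smul_right,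
        inner_bochnerField_self (hW.differentiable (by norm_num) x) htan (sub_ne_zero.2 hx), mul_zero, add_zero]
  -- integrability of `div V` (continuous, compact support) and the pointwise inequality
  have hdivVc : Continuous (divergence V) := continuous_divergence (hV.continuous_fderiv one_ne_zero)
  have hdivV_supp : HasCompactSupport (divergence V) := by
    refine hVc.mono' ?_
    intro x hx
    contrapose! hx
    simp only [Function.mem_support, ne_eq, not_not]
    exact divergence_eq_zero_of_notMem_tsupport hx
  have hI1 : Integrable (fun x => g x * divergence (bochnerField x₀ W) x) := by
    have e : (fun x => g x * divergence (bochnerField x₀ W) x) = divergence V := funext fun x => (hdivV x).symm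
    rw [e]
    exact hdivVc.integrable_of_hasCompactSupport hdivV_supp
  -- the other two integrands: `g · (continuous off the centre)` is continuous with compact support
  have hWc : Continuous W := hW.continuous
  have hdivWc : Continuous (divergence W) := continuous_divergence (hW.continuous_fderiv (by norm_num))
  have hsupp_g : ∀ f : E3 → ℝ, HasCompactSupport fun x => g x * f x := by
    intro f
    refine HasCompactSupport.intro (isCompact_closedBall x₀ (|S| + 1)) fun x hx => ?_
    rw [Metric.mem_closedBall, dist_eq_norm, not_le] at hx
    have h1 : 1 ≤ ‖x - x₀‖ := by linarith [abs_nonneg S]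
    have hS' : S ≤ ‖x - x₀‖ ^ 2 := by nlinarith [le_abs_self S]
    show g x * f x = 0
    rw [hg_def]; dsimp only
    rw [hκS _ hS', zero_mul]
  have hc2 : Continuous fun x => g x * (‖W x‖ ^ 2 / ‖x - x₀‖ ^ 2) := by
    have hf : ContDiffOn ℝ 0 (fun x => ‖W x‖ ^ 2 / ‖x - x₀‖ ^ 2) {x₀}ᶜ := by
      rw [contDiffOn_zero]
      refine (hWc.norm.pow 2).continuousOn.div
        ((continuous_norm.comp (continuous_id.sub continuous_const)).pow 2).continuousOn fun x hx => ?_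
      exact pow_ne_zero 2 (norm_ne_zero_iff.2 (sub_ne_zero.2 hx))
    have h := contDiff_smul_of_vanishing (n := 0) (F := ℝ) hρ (hg.of_le (by norm_num)) hg0 hf
    exact contDiff_zero.1 h
  have hI2 : Integrable fun x => g x * (‖W x‖ ^ 2 / ‖x - x₀‖ ^ 2) :=
    hc2.integrable_of_hasCompactSupport (hsupp_g _)
  have hI3 : Integrable fun x => g x * divergence W x ^ 2 :=
    (hg.continuous.mul (hdivWc.pow 2)).integrable_of_hasCompactSupport (hsupp_g _)
  have hcurlc : Continuous (curl W) := by
    rw [curl_eq_curlCLM_comp]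
    exact curlCLM.continuous.comp (hW.continuous_fderiv (by norm_num))
  have hc4 : Continuous fun x => g x * (⟪curl W x, x - x₀⟫ ^ 2 / ‖x - x₀‖ ^ 2) := by
    have hf : ContDiffOn ℝ 0 (fun x => ⟪curl W x, x - x₀⟫ ^ 2 / ‖x - x₀‖ ^ 2) {x₀}ᶜ := by
      rw [contDiffOn_zero]
      refine ((hcurlc.inner (continuous_id.sub continuous_const)).pow 2).continuousOn.div
        ((continuous_norm.comp (continuous_id.sub continuous_const)).pow 2).continuousOn fun x hx => ?_
      exact pow_ne_zero 2 (norm_ne_zero_iff.2 (sub_ne_zero.2 hx))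
    have h := contDiff_smul_of_vanishing (n := 0) (F := ℝ) hρ (hg.of_le (by norm_num)) hg0 hf
    exact contDiff_zero.1 h
  have hI4 : Integrable fun x => g x * (⟪curl W x, x - x₀⟫ ^ 2 / ‖x - x₀‖ ^ 2) :=
    hc4.integrable_of_hasCompactSupport (hsupp_g _)
  -- pointwise inequality, everywhere
  have hpt : ∀ x, g x * divergence (bochnerField x₀ W) x + g x * (‖W x‖ ^ 2 / ‖x - x₀‖ ^ 2) ≤
      (1 / 2) * (g x * divergence W x ^ 2) + (1 / 2) * (g x * (⟪curl W x, x - x₀⟫ ^ 2 / ‖x - x₀‖ ^ 2)) := by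
    intro x
    by_cases hx : x = x₀
    · subst hx
      rw [hg0 x (Metric.mem_ball_self hρ)]
      simp
    · have key := divergence_bochnerField_add_le_defect hW.contDiffAt (sub_ne_zero.2 hx) htan
      have hgx : 0 ≤ g x := hκnn _
      have := mul_le_mul_of_nonneg_left key hgx
      have e : (‖x - x₀‖ ^ 2)⁻¹ * ⟪curl W x, x - x₀⟫ ^ 2 / 2 = (1 / 2) * (⟪curl W x, x - x₀⟫ ^ 2 / ‖x - x₀‖ ^ 2) := by
        ring
      rw [e] at this
      linarith [this]
  have hmono : ∫ x, (g x * divergence (bochnerField x₀ W) x + g x * (‖W x‖ ^ 2 / ‖x - x₀‖ ^ 2)) ≤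
      ∫ x, ((1 / 2) * (g x * divergence W x ^ 2) + (1 / 2) * (g x * (⟪curl W x, x - x₀⟫ ^ 2 / ‖x - x₀‖ ^ 2))) :=
    integral_mono (hI1.add hI2) ((hI3.const_mul (1 / 2)).add (hI4.const_mul (1 / 2))) hpt
  rw [integral_add hI1 hI2, integral_add (hI3.const_mul (1 / 2)) (hI4.const_mul (1 / 2)), integral_const_mul,
    integral_const_mul] at hmono
  have e : ∫ x, g x * divergence (bochnerField x₀ W) x = 0 := by
    rw [show (fun x => g x * divergence (bochnerField x₀ W) x) = divergence V from funext fun x => (hdivV x).symm]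
    exact hint0
  rw [e, zero_add] at hmono
  exact hmono


end Hodge

end Summit.NavierStokesRegularity.NavierStokesRegularity.Theorems.PoloidalLiouville.CentreVirial
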